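import Mathlib
import HarnessLib
import Summits.HubbardSuperconductivity.HubbardSuperconductivity.Theorems.KLProgrammeKLRegimeEngineTwoLegStepV17F2Closers

/-!
# K3 gen 8, ENGINE child `KLRegimeEngineV17F2` (stmt-HubbardSuperconductivity-20437): the (e)/(M) closer shells of `…EngineTwoLegStepV17F2Closers`
# THRESHOLD-PARAMETRIC in token #10 (`klEngU₀6 ↦ klEngU₀8`/`klEngU₀9`/… — plan g17 (R41)(iii)/(R41c), identifier still moving at 12:55Z): any
# coupling door `U₀c ≤ klEngU₀4 P R c` and any regime-constant door `c₃ ≤ klEngC₃3 P R`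

Cell gate-hubbard-kl, seat hubbard-kl-r2d-p1 (g5).  The 20437 render's stub thresholds are DOORS below the v4/v3 package thresholds (`klEngU₀6/7/8/9 … ≤ klEngU₀4`, `klEngC₃6 ≤ klEngC₃3`, …DefsU6/U7/U8);
rather than one twin per identifier (p531478 at `klEngU₀6`, p532097 at `klEngU₀7`), this file states the two shells ONCE for an arbitrary pair of doors
`(c₃, U₀c)` with `c₃ ≤ klEngC₃3 P R`, `U₀c ≤ klEngU₀4 P R c` — the stub closer passes e.g. `(klEngC₃6_le_klEngC₃3 P R) (klEngU₀9_le_klEngU₀4 P R c)`: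

* `stub_twoLeg_step_of_residuals_thr` — stub (e)'s literal binders at the doors `(c₃, U₀c)` + rows B1–B3, C1–C2 ⇒ `TwoLegStepV17F2 L M klEngGeo7 P (klEngQ6 P R) R β U μ n`;
* `stub_twoLeg_scale0_of_twoLegStepV17F_zero_thr` — stub (M)'s literal binders at the doors + the rev-1 text `TwoLegStepV17F … 0` ⇒ the rev-2 conclusion.

Proofs only; nothing about the model is asserted; nothing asserts superconductivity.  [cite: BenfattoGiulianiMastropietro2006] (§2.4 (2.36)).
-/

noncomputable section

namespace Summit.HubbardSuperconductivity.HubbardSuperconductivity.Theorems.EngineV8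

set_option linter.dupNamespace false -- summit = problem name (single-conjunct summit), D-0017

open Real Finset Literature.MathematicalPhysics.QuantumLattice Literature.Probability.LatticeModels
open Literature.MathematicalPhysics.QuantumLattice.FermiRG Literature.MathematicalPhysics.QuantumLattice.BandSectorCounting
open Summit.HubbardSuperconductivity.HubbardSuperconductivity.Theorems.KLProgrammeLegKernels
open Summit.HubbardSuperconductivity.HubbardSuperconductivity.Theorems.DispersionFlow
open Summit.HubbardSuperconductivity.HubbardSuperconductivity.Theorems.PerturbedFermiCurve
open Summit.HubbardSuperconductivity.HubbardSuperconductivity.Theorems.KLRegimeSplit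
open Summit.HubbardSuperconductivity.HubbardSuperconductivity.Theorems.TwoPointAssembly

/-- **STUB (e) `stub_twoLeg_step` OF 20437 MODULO ITS NAMED RESIDUALS, doors `c ≤ c₃ ≤ klEngC₃3 P R`, `U ≤ U₀c ≤ klEngU₀4 P R c`.**  The stub's literal binders (render twin B2 + token #7), then: B1 `hz` (shell field
strength at `K_n`), B2 `hm₁'` (shell-tube gradient of the `K_n`-separated reading), B3 `hfit1` (p1b's fit), C1 `hcut` / C2 `hsp` (the two nested legs at scale `n`,
comparison histories `histV17F2 ∧ slopes`).  Conclusion = the stub's.  (`hP`, `hM`, `hn1`, `hreg`, `hhist`, `hE` are carried for the literal shape only.) -/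
theorem stub_twoLeg_step_of_residuals_thr {c₃ U₀c : ℝ} (P : SplitConsts) (R : RenConsts) (c : ℝ) (hc₃ : c₃ ≤ klEngC₃3 P R)
    (hU₀ : U₀c ≤ klEngU₀4 P R c) (hP : P.WF) (hR : R.WF2) (hc : 0 < c) (hc3 : c ≤ c₃)
    (μ : ℝ) (hμ : μ ∈ klWindowC) (U : ℝ) (hU : 0 < U) (hUle : U ≤ U₀c) (β : ℝ) (hβ : klBetaMin ≤ β) (hβc : β ≤ Real.exp (c / U ^ 2))
    (L M : ℕ) [NeZero L] [NeZero M] (hL : klEngL₃ β U ≤ L) (hM : klEngM₃ β U L ≤ M)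
    (n : ℕ) (hn1 : 1 ≤ n) (hn : n ≤ nScales β + 1) (hreg : IsKLRegime U c (-(n : ℤ)))
    (hhist : HistP klPredsV17F2 L M klEngGeo7 P (klEngQ6 P R) R β U μ 0 n)
    (hfr : FrameOK R U (nScales β) μ (klFlowFrameU L M β U μ n))
    (hE : EngineBoundsAtV17F2 L M klEngGeo7 P (klEngQ6 P R) β U μ n)
    (hJ : TwoLegReadJetBound L M klC4aJetC (klC4aJetC' P R) β U μ (klFlowFrameU L M β U μ n) n)
    -- residual rows B1–B3 (engine numbers at the flow frame)
    (hz : ∀ k ∈ klShell L μ (klFlowFrameU L M β U μ n) n, |klFieldStrength L M β U μ (klFlowFrameU L M β U μ n) n k - 1| ≤ R.cz * |U|)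
    {m₁' : ℝ}
    (hm₁' : ∀ q : Momentum, |frameLevel μ (klFlowFrameU L M β U μ n) q| ≤ klScale klE0 n →
      ‖fderiv ℝ (evalM (symInterp L (fun p => klLocSelfEnergyRe L M β U μ (klFlowFrameU L M β U μ n) n p -
        (klFlowFrameU L M β U μ n).eval (latticeMomentum L p)))) q‖ ≤ m₁')
    (hfit1 : m₁' + 4 / 3 * R.Gfr 1 * U ^ 2 ≤ R.cz * |U| * (cDtmin (-1.2) (-0.05) / 2))
    -- residual rows C1–C2 (the two nested legs; VL / two-volume numbers)
    (hcut : ∀ (Mq : ℕ → ℕ) (L₁ M₁ M₂ : ℕ) [NeZero L₁] [NeZero M₁] [NeZero M₂], L ≤ L₁ → (klEngQ6 P R).M0 β L₁ ≤ M₁ → Mq L₁ ≤ M₁ → M₁ ≤ M₂ →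
      (∀ j < n, histV17F2 L₁ M₁ klEngGeo7 P (klEngQ6 P R) R β U μ j ∧ TwoLegSlopes L₁ M₁ R β U μ (klFlowFrameU L₁ M₁ β U μ j) j) →
      (∀ j < n, histV17F2 L₁ M₂ klEngGeo7 P (klEngQ6 P R) R β U μ j ∧ TwoLegSlopes L₁ M₂ R β U μ (klFlowFrameU L₁ M₂ β U μ j) j) →
        ∀ θ : ℝ, |klLocalPart L₁ M₁ β U μ (klFlowFrameU L₁ M₁ β U μ n) n θ -
          klLocalPart L₁ M₂ β U μ (klFlowFrameU L₁ M₂ β U μ n) n θ| ≤ (klEngQ6 P R).CL β n / 4 / L₁)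
    (hsp : ∀ (Mq : ℕ → ℕ) (L₁ L₂ M₂ : ℕ) [NeZero L₁] [NeZero L₂] [NeZero M₂], L ≤ L₁ → L₁ ∣ L₂ → (klEngQ6 P R).M0 β L₁ ≤ M₂ → Mq L₁ ≤ M₂ →
      (klEngQ6 P R).M0 β L₂ ≤ M₂ → Mq L₂ ≤ M₂ →
      (∀ j < n, histV17F2 L₁ M₂ klEngGeo7 P (klEngQ6 P R) R β U μ j ∧ TwoLegSlopes L₁ M₂ R β U μ (klFlowFrameU L₁ M₂ β U μ j) j) →
      (∀ j < n, histV17F2 L₂ M₂ klEngGeo7 P (klEngQ6 P R) R β U μ j ∧ TwoLegSlopes L₂ M₂ R β U μ (klFlowFrameU L₂ M₂ β U μ j) j) →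
        ∀ θ : ℝ, |klLocalPart L₁ M₂ β U μ (klFlowFrameU L₁ M₂ β U μ n) n θ -
          klLocalPart L₂ M₂ β U μ (klFlowFrameU L₂ M₂ β U μ n) n θ| ≤ (klEngQ6 P R).CL β n / 4 / L₁) :
    TwoLegStepV17F2 L M klEngGeo7 P (klEngQ6 P R) R β U μ n := by
  have _ := hP; have _ := hM; have _ := hn1; have _ := hreg; have _ := hhist; have _ := hE
  exact twoLegStepV17F2_of_jets_sepTubeGradient_nestedLegs_pkg klEngGeo7 (klEngQ6 P R) P hR hc (hc3.trans hc₃) hμ hU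
    (hUle.trans hU₀) hβ hβc hL hn hfr (klEngQ6_CL_nonneg P R β n) klC4aJetC_le_klEngGeo7_S (klC4aJetC'_le_klEngQ6_S' P R)
    hJ.1 hJ.2 hz hm₁' hfit1 hcut hsp


/-- **STUB (M) OF 20437 FROM p1b's REV-1 BARE-FRAME ASSEMBLY, token #10**: the stub's literal binders + `TwoLegStepV17F L M klEngGeo7 P (klEngQ6 P R) R β U μ 0` (the
conclusion of `twoLegStepV17F_zero_bareFrame` at `G := klEngGeo7`, `Q := klEngQ6 P R`) ⇒ the stub's conclusion. -/
theorem stub_twoLeg_scale0_of_twoLegStepV17F_zero_thr {c₃ U₀c : ℝ} (P : SplitConsts) (R : RenConsts) (c : ℝ) (hP : P.WF) (hR : R.WF2)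
    (hc : 0 < c) (hc3 : c ≤ c₃) (μ : ℝ) (hμ : μ ∈ klWindowC) (U : ℝ) (hU : 0 < U) (hUle : U ≤ U₀c) (β : ℝ) (hβ : klBetaMin ≤ β)
    (hβc : β ≤ Real.exp (c / U ^ 2)) (L M : ℕ) [NeZero L] [NeZero M] (hL : klEngL₃ β U ≤ L) (hM : klEngM₃ β U L ≤ M)
    (hfr : FrameOK R U (nScales β) μ (klFlowFrameU L M β U μ 0))
    (hE : EngineBoundsAtV17F2 L M klEngGeo7 P (klEngQ6 P R) β U μ 0)
    (hJ : TwoLegReadJetBound L M klC4aJetC (klC4aJetC' P R) β U μ (klFlowFrameU L M β U μ 0) 0)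
    (h : TwoLegStepV17F L M klEngGeo7 P (klEngQ6 P R) R β U μ 0) :
    TwoLegStepV17F2 L M klEngGeo7 P (klEngQ6 P R) R β U μ 0 := by
  have _ := hP; have _ := hR; have _ := hc; have _ := hc3; have _ := hμ; have _ := hU; have _ := hUle; have _ := hβ; have _ := hβc
  have _ := hL; have _ := hM; have _ := hfr; have _ := hE; have _ := hJ
  exact (twoLegStepV17F2_zero_iff_V17F_zero klEngGeo7 P (klEngQ6 P R) R β U μ).2 h

end Summit.HubbardSuperconductivity.HubbardSuperconductivity.Theorems.EngineV8

end
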